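import Summits.QuantumFields.QCD.Theorems.QuarksAsStableActionStableActionBridgeStubFockGaugeActChargeConj
import HarnessLib

/-!
# The charge-conjugation matrix `𝒱 = P_hᴴ Γ(1 ⊗ w)` sends mode-number sector `n₀` to sector `#modes − n₀`
(stub `stub_chargeConjMatrix_sector` of line `twisted_trace_transfer` for crux
`QuarksAsStableAction.StableActionBridge`, item stmt-QuantumFields-9737, `--supports`; sub-goal W7b)

In the vacuum-parity argument of step E3 of the line, charge conjugation acts on the slice Fock space
`ℂ^{Finset (SliceFermiIdx Nf S)}` of lattice QCD through the matrix
`𝒱 = P_hᴴ Γ(1 ⊗ w)` (`P_h = particleHole 1` the particle–hole map, `Γ = fockLift` the second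
quantisation of the one-particle spin rotation `1 ⊗ w`, `w = C γ₄`, `C = chargeConj`; Smit,
*Introduction to Quantum Fields on a Lattice*, §4.6 (4.124)–(4.127)).  Clause (c) of the landed
sub-goal V1 (`stub_fockGaugeAct_chargeConj`, helper
`StubFockGaugeActChargeConj.particleHole_conjTranspose_mul_fockLift_apply`) is the selection rule
`𝒱_{s t} = 0` unless `#s + #t = D₁ := Fintype.card (SliceFermiIdx Nf S)`.  Consequently a Fock vector
`v` supported in the mode-number sector `n₀` (`v t = 0` whenever `#t ≠ n₀`) is mapped to a vector
supported in sector `D₁ − n₀`: `(𝒱 v)_s = Σ_t 𝒱_{s t} v_t`, and every term vanishes — if `#t ≠ n₀` then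
`v_t = 0`, otherwise `#s + #t = #s + n₀ ≠ D₁` and `𝒱_{s t} = 0`.

Pure theorem file (no definitions, no local notations).

[cite: Smit2023, §4.6 (4.124)–(4.127)]
-/

open scoped Matrix BigOperators ComplexConjugate
open Literature.MathematicalPhysics.QuantumFieldTheory Literature.MathematicalPhysics.QuantumLattice

namespace Summit.QuantumFields.QCD.Cruxes.StableActionBridge.TwistedTraceTransfer

/-- **Sub-goal W7b (registered stub `stub_chargeConjMatrix_sector`): the charge-conjugation matrix
`𝒱 = P_hᴴ Γ(1 ⊗ C γ₄)` maps the mode-number sector `n₀` into the sector `#modes − n₀`.**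
If `v` vanishes off `{t | #t = n₀}` and `#s + n₀ ≠ #modes`, then `(𝒱 v)_s = Σ_t 𝒱_{s t} v_t = 0`
term by term: either `#t ≠ n₀` and `v_t = 0`, or `#s + #t ≠ #modes` and `𝒱_{s t} = 0` by the
selection rule of `P_hᴴ Γ(X)` (`P_h` is supported on complements, `Γ(X)` preserves `#t`).
[cite: Smit2023, §4.6 (4.124)–(4.127)] -/
theorem stub_chargeConjMatrix_sector : ∀ (Nf S : ℕ) [NeZero S] (v : Finset (SliceFermiIdx Nf S) → ℂ) (n₀ : ℕ),
    (∀ s : Finset (SliceFermiIdx Nf S), s.card ≠ n₀ → v s = 0) →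
    ∀ s : Finset (SliceFermiIdx Nf S), s.card + n₀ ≠ Fintype.card (SliceFermiIdx Nf S) →
      (((particleHole (fun _ : SliceFermiIdx Nf S => (1 : ℂ)))ᴴ * fockLift (Matrix.reindex sliceQuarkEquiv sliceQuarkEquiv
        (sliceKron (1 : Matrix (SliceColourVar Nf S) (SliceColourVar Nf S) ℂ) (chargeConj * euclideanGamma 0)))) *ᵥ v) s = 0 := by
  intro Nf S _ v n₀ hv s hs
  rw [Matrix.mulVec_apply_eq_sum]
  refine Finset.sum_eq_zero fun t _ => ?_
  by_cases ht : t.card = n₀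
  · have hst : s.card + t.card ≠ Fintype.card (SliceFermiIdx Nf S) := by rwa [ht]
    rw [StubFockGaugeActChargeConj.particleHole_conjTranspose_mul_fockLift_apply _ _ hst, zero_mul]
  · rw [hv t ht, mul_zero]

end Summit.QuantumFields.QCD.Cruxes.StableActionBridge.TwistedTraceTransfer
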